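import Mathlib
import HarnessLib

/-!
# `NoHeavyLowerTail` (stmt-CriticalPhenomena-4575) — the two-lonely-children gluing kernel in CONFIGURATION (β):
# the algebraic core (pure real inequalities), machine-checked

Support file (depth prover `prim-nh-dp-blobmono` gen 8, 2026-08-19; `--supports stmt-CriticalPhenomena-4575`).
No definitions, no named facts, no sorries.  Paper proof and exact numerics: the seat's memo `PROOF-BETA.md`
(run/shared/lean/prim/prim-nh-dp-blobmono/gen8-g8/).

CONFIGURATION (β) (the lead's LEAD-GEN7 §3e, second minimal open instance of the kernel; prim-hp-2 gen 4 §0(v)): relays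
`A = {b, p₁, p₂, q₁, q₂}`, hub links `p₁–b (u₁)`, `p₂–b (u₂)`, `q₁–b (v₁)`, `q₂–b (v₂)`, ONE relay–relay edge `p₁–q₁ (w)`, pendant
stars `x = {p₁ (h₁), p₂ (h₂)}`, `y = {q₁ (g₁), q₂ (g₂)}`, `H = K + x + y`, witness `a₀ = p₁` (an end of the relay–relay edge).  After
prim-hp-2's port-free reduction (`h₁ ↦ 0`, `c(p₁) = (1−h₁)·c′`) every quantity in the gluing inequality
`GC: c′ = P_{H/xy}(x̄↔b) − P_{H/xy}(p₁↔b) + P(all hairs closed)·m_K ≥ 0` is an explicit polynomial, because the `K`-routes are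
edge-disjoint:
  `ρ₁ = P_K(p₁↔b) = 1 − (1−u₁)(1−w v₁)`, `σ₁ = P_K(q₁↔b) = 1 − (1−v₁)(1−w u₁)`, `τ = (1−u₁)(1−v₁)w`,
  `R = 1 − (1−h₂u₂)(1−g₂v₂)` (`x̄` reaches `b` through `p₂` or `q₂`), `π∅ = (1−h₂)(1−g₁)(1−g₂)`, `m = m_K = min(ρ₁, σ₁, u₂, v₂)`,
  `c′ = R + (1−R)·g₁σ₁ + π∅·m − ρ₁ − g₁·R·τ`  (`g₁Rτ` = the witness's third-party gain through the edge `w`),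
and the hypothesis "`p₁ ∈ argmin_A P_{H′}(·↔b)`" (`H′` = `H` with the hair `x–p₁` deleted, loser-lowering) is the three rows
  `ρ₁ + τ g₁g₂v₂ ≤ σ₁ + (1−v₁)(1−w u₁) g₁g₂v₂`,  `ρ₁ + τ g₁g₂v₂ ≤ u₂`,  `ρ₁ + τ g₁g₂v₂ ≤ v₂ + (1−v₂) g₁g₂ σ₁`.
This file proves, over `ℝ` with all weights in `[0,1]`: ROWS ⇒ `c′ ≥ 0` (`KernelBeta.core`), by the case analysis of the memo
(which relay is `K`-loneliest; each case uses ONE row and the affine decomposition of `c′` along one hair of `y`):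
* `KernelBeta.case_rho` — `m = ρ₁` (Theorem-4 case): `c′ = Θ(ρ₁)(1 − g₁(ρ₁+τ)) + (1−R)g₁(σ₁−ρ₁) + ρ₁g₁(1−P₀)(1−ρ₁−τ)`;
* `KernelBeta.case_sigma` — `m = σ₁` (`q₁` loneliest): `c′ = g₁(1−w)R(1−v₁) + (1−g₁)Θ(σ₁) − (1−w)(u₁−v₁)` and the `q₁`-row;
* `KernelBeta.case_v` — `m = v₂` (`q₂` loneliest): `c′ = (g₁g₂Ψ − δ) + g₂h₂u₂(1−v₂)(1−g₁(σ₁+τ)) + (1−g₂)·[…≥0]` and the `q₂`-row;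
* `KernelBeta.core` — the assembled statement (`m` any common lower bound of `ρ₁, σ₁, u₂, v₂` attained by one of them).
The probabilistic identification (the closed forms above from `prodBernoulli` on the 7-vertex graph, and the port-free reduction) is
NOT in this file; with it, `core` discharges `hGC` of `SpiderGluing.knGood_twoStars_hairs_of_gluing` on configuration (β), i.e. the
observer with children `x, y` over the core "hub-star + one relay–relay edge" is Kozma–Nitzan good.
-/

namespace Summit.CriticalPhenomena.PercolationContinuityZ3.Theorems

namespace KernelBeta

/-- The Theorem-4 slack of the glued star against a level `m`: `R − m(h₂+g₂−h₂g₂)` splits into three nonnegative terms when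
`u₂, v₂ ≥ m`. [this work] -/
theorem theta_eq (u₂ v₂ h₂ g₂ m : ℝ) :
    (1 - (1 - h₂ * u₂) * (1 - g₂ * v₂)) - m * (h₂ + g₂ - h₂ * g₂) =
      h₂ * (1 - g₂) * (u₂ - m) + g₂ * (1 - h₂) * (v₂ - m) + h₂ * g₂ * (u₂ + v₂ - u₂ * v₂ - m) := by
  ring

/-- Nonnegativity of the Theorem-4 slack `Θ(m) = R − m(h₂+g₂−h₂g₂)` for `m ≤ u₂, v₂`, weights in `[0,1]`. [this work] -/
theorem theta_nonneg (u₂ v₂ h₂ g₂ m : ℝ) (hu₂ : u₂ ≤ 1) (hv₂ : 0 ≤ v₂)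
    (hh₂ : 0 ≤ h₂) (hh₂' : h₂ ≤ 1) (hg₂ : 0 ≤ g₂) (hg₂' : g₂ ≤ 1) (hmu : m ≤ u₂) (hmv : m ≤ v₂) :
    0 ≤ (1 - (1 - h₂ * u₂) * (1 - g₂ * v₂)) - m * (h₂ + g₂ - h₂ * g₂) := by
  rw [theta_eq]
  have h1 : 0 ≤ h₂ * (1 - g₂) * (u₂ - m) := by
    apply mul_nonneg (mul_nonneg hh₂ (by linarith)) (by linarith)
  have h2 : 0 ≤ g₂ * (1 - h₂) * (v₂ - m) := by
    apply mul_nonneg (mul_nonneg hg₂ (by linarith)) (by linarith)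
  have h3 : 0 ≤ u₂ + v₂ - u₂ * v₂ - m := by nlinarith
  have h4 : 0 ≤ h₂ * g₂ * (u₂ + v₂ - u₂ * v₂ - m) := mul_nonneg (mul_nonneg hh₂ hg₂) h3
  linarith

/-- **Case `m = ρ₁`** (the witness is also `K`-loneliest; Kozma–Nitzan Theorem 4 termwise).  With `P₀ = (1−h₂)(1−g₂)`:
`c′ = Θ(ρ₁)·(1 − g₁(ρ₁+τ)) + (1−R)g₁(σ₁−ρ₁) + ρ₁ g₁ (1−P₀)(1 − ρ₁ − τ) ≥ 0` when `σ₁, u₂, v₂ ≥ ρ₁`. [this work] -/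
theorem case_rho (u₁ v₁ w u₂ v₂ h₂ g₁ g₂ : ℝ)
    (hu₁ : 0 ≤ u₁) (hu₁' : u₁ ≤ 1) (hv₁ : 0 ≤ v₁) (hv₁' : v₁ ≤ 1) (hw : 0 ≤ w) (hw' : w ≤ 1)
    (_hu₂ : 0 ≤ u₂) (hu₂' : u₂ ≤ 1) (hv₂ : 0 ≤ v₂) (hv₂' : v₂ ≤ 1)
    (hh₂ : 0 ≤ h₂) (hh₂' : h₂ ≤ 1) (hg₁ : 0 ≤ g₁) (hg₁' : g₁ ≤ 1) (hg₂ : 0 ≤ g₂) (hg₂' : g₂ ≤ 1)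
    (hσ : 1 - (1 - u₁) * (1 - w * v₁) ≤ 1 - (1 - v₁) * (1 - w * u₁))
    (hmu : 1 - (1 - u₁) * (1 - w * v₁) ≤ u₂) (hmv : 1 - (1 - u₁) * (1 - w * v₁) ≤ v₂) :
    0 ≤ (1 - (1 - h₂ * u₂) * (1 - g₂ * v₂))
        + (1 - h₂ * u₂) * (1 - g₂ * v₂) * g₁ * (1 - (1 - v₁) * (1 - w * u₁))
        + (1 - h₂) * (1 - g₁) * (1 - g₂) * (1 - (1 - u₁) * (1 - w * v₁))
        - (1 - (1 - u₁) * (1 - w * v₁))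
        - g₁ * (1 - (1 - h₂ * u₂) * (1 - g₂ * v₂)) * ((1 - u₁) * (1 - v₁) * w) := by
  -- abbreviations as plain hypotheses-free `have`s
  set ρ := 1 - (1 - u₁) * (1 - w * v₁) with hρ
  set σ := 1 - (1 - v₁) * (1 - w * u₁) with hσdef
  set τ := (1 - u₁) * (1 - v₁) * w with hτ
  set R := 1 - (1 - h₂ * u₂) * (1 - g₂ * v₂) with hR
  have hhu : h₂ * u₂ ≤ 1 := by nlinarith [mul_nonneg hh₂ (sub_nonneg.2 hu₂')]
  have hgv : g₂ * v₂ ≤ 1 := by nlinarith [mul_nonneg hg₂ (sub_nonneg.2 hv₂')]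
  have hR1 : R ≤ 1 := by
    rw [hR]; nlinarith [mul_nonneg (sub_nonneg.2 hhu) (sub_nonneg.2 hgv)]
  have hwv : w * v₁ ≤ 1 := by nlinarith [mul_nonneg hw (sub_nonneg.2 hv₁')]
  have hρ0 : 0 ≤ ρ := by
    rw [hρ]; nlinarith [mul_nonneg (sub_nonneg.2 hu₁') (mul_nonneg hw hv₁), mul_nonneg hu₁ (sub_nonneg.2 hwv)]
  have hS : ρ + τ = u₁ + (1 - u₁) * w := by rw [hρ, hτ]; ring
  have hS1 : ρ + τ ≤ 1 := by rw [hS]; nlinarith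
  -- the identity
  have hid : R + (1 - h₂ * u₂) * (1 - g₂ * v₂) * g₁ * σ + (1 - h₂) * (1 - g₁) * (1 - g₂) * ρ - ρ - g₁ * R * τ
      = (R - ρ * (h₂ + g₂ - h₂ * g₂)) * (1 - g₁ * (ρ + τ)) + (1 - R) * g₁ * (σ - ρ)
        + ρ * g₁ * (h₂ + g₂ - h₂ * g₂) * (1 - ρ - τ) := by
    rw [hR]; ring
  have hΘ : 0 ≤ R - ρ * (h₂ + g₂ - h₂ * g₂) := by
    rw [hR]; exact theta_nonneg u₂ v₂ h₂ g₂ ρ hu₂' hv₂ hh₂ hh₂' hg₂ hg₂' hmu hmv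
  have hS0 : 0 ≤ ρ + τ := by rw [hS]; nlinarith [mul_nonneg (sub_nonneg.2 hu₁') hw]
  have hgS : g₁ * (ρ + τ) ≤ ρ + τ := by nlinarith [mul_nonneg (sub_nonneg.2 hg₁') hS0]
  have hA : 0 ≤ (R - ρ * (h₂ + g₂ - h₂ * g₂)) * (1 - g₁ * (ρ + τ)) :=
    mul_nonneg hΘ (by linarith)
  have hB : 0 ≤ (1 - R) * g₁ * (σ - ρ) := mul_nonneg (mul_nonneg (by linarith) hg₁) (by linarith)
  have hpg : 0 ≤ h₂ + g₂ - h₂ * g₂ := by nlinarith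
  have hC : 0 ≤ ρ * g₁ * (h₂ + g₂ - h₂ * g₂) * (1 - ρ - τ) :=
    mul_nonneg (mul_nonneg (mul_nonneg hρ0 hg₁) hpg) (by linarith)
  have hmain : 0 ≤ R + (1 - h₂ * u₂) * (1 - g₂ * v₂) * g₁ * σ + (1 - h₂) * (1 - g₁) * (1 - g₂) * ρ - ρ - g₁ * R * τ := by
    rw [hid]; linarith
  simpa [hR, hρ, hσdef, hτ] using hmain

/-- **Case `m = σ₁`** (`q₁` is `K`-loneliest: `σ₁ ≤ u₂, v₂`), from the single row "`p₁` no more `H′`-reliable than `q₁`":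
`(u₁−v₁)(1−w) ≤ g₁g₂v₂(1−v₁)(1−w)`.  Identity `c′ = g₁(1−w)R(1−v₁) + (1−g₁)Θ(σ₁) − (1−w)(u₁−v₁)` (affine decomposition along the
hair `y–q₁`) and `R ≥ g₂v₂`. [this work] -/
theorem case_sigma (u₁ v₁ w u₂ v₂ h₂ g₁ g₂ : ℝ)
    (_hu₁ : 0 ≤ u₁) (_hu₁' : u₁ ≤ 1) (_hv₁ : 0 ≤ v₁) (hv₁' : v₁ ≤ 1) (_hw : 0 ≤ w) (hw' : w ≤ 1)
    (hu₂ : 0 ≤ u₂) (hu₂' : u₂ ≤ 1) (hv₂ : 0 ≤ v₂) (hv₂' : v₂ ≤ 1)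
    (hh₂ : 0 ≤ h₂) (hh₂' : h₂ ≤ 1) (hg₁ : 0 ≤ g₁) (hg₁' : g₁ ≤ 1) (hg₂ : 0 ≤ g₂) (hg₂' : g₂ ≤ 1)
    (hmu : 1 - (1 - v₁) * (1 - w * u₁) ≤ u₂) (hmv : 1 - (1 - v₁) * (1 - w * u₁) ≤ v₂)
    (hrow : (u₁ - v₁) * (1 - w) ≤ g₁ * g₂ * v₂ * (1 - v₁) * (1 - w)) :
    0 ≤ (1 - (1 - h₂ * u₂) * (1 - g₂ * v₂))
        + (1 - h₂ * u₂) * (1 - g₂ * v₂) * g₁ * (1 - (1 - v₁) * (1 - w * u₁))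
        + (1 - h₂) * (1 - g₁) * (1 - g₂) * (1 - (1 - v₁) * (1 - w * u₁))
        - (1 - (1 - u₁) * (1 - w * v₁))
        - g₁ * (1 - (1 - h₂ * u₂) * (1 - g₂ * v₂)) * ((1 - u₁) * (1 - v₁) * w) := by
  set ρ := 1 - (1 - u₁) * (1 - w * v₁) with hρ
  set σ := 1 - (1 - v₁) * (1 - w * u₁) with hσdef
  set τ := (1 - u₁) * (1 - v₁) * w with hτ
  set R := 1 - (1 - h₂ * u₂) * (1 - g₂ * v₂) with hR
  have hid : R + (1 - h₂ * u₂) * (1 - g₂ * v₂) * g₁ * σ + (1 - h₂) * (1 - g₁) * (1 - g₂) * σ - ρ - g₁ * R * τ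
      = g₁ * (1 - w) * R * (1 - v₁) + (1 - g₁) * (R - σ * (h₂ + g₂ - h₂ * g₂)) - (1 - w) * (u₁ - v₁) := by
    rw [hR, hρ, hσdef, hτ]; ring
  have hΘ : 0 ≤ R - σ * (h₂ + g₂ - h₂ * g₂) := by
    rw [hR]; exact theta_nonneg u₂ v₂ h₂ g₂ σ hu₂' hv₂ hh₂ hh₂' hg₂ hg₂' hmu hmv
  have hgv : g₂ * v₂ ≤ 1 := by nlinarith [mul_nonneg hg₂ (sub_nonneg.2 hv₂')]
  have hRg : g₂ * v₂ ≤ R := by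
    rw [hR]; nlinarith [mul_nonneg (mul_nonneg hh₂ hu₂) (sub_nonneg.2 hgv)]
  -- (1−w)(u₁−v₁) ≤ g₁(1−w)(1−v₁)·g₂v₂ ≤ g₁(1−w)(1−v₁)·R
  have hk : 0 ≤ g₁ * (1 - w) * (1 - v₁) := mul_nonneg (mul_nonneg hg₁ (by linarith)) (by linarith)
  have h1 : (1 - w) * (u₁ - v₁) ≤ g₁ * (1 - w) * (1 - v₁) * (g₂ * v₂) := by nlinarith
  have h2 : g₁ * (1 - w) * (1 - v₁) * (g₂ * v₂) ≤ g₁ * (1 - w) * (1 - v₁) * R :=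
    mul_le_mul_of_nonneg_left hRg hk
  have h3 : 0 ≤ (1 - g₁) * (R - σ * (h₂ + g₂ - h₂ * g₂)) := mul_nonneg (by linarith) hΘ
  have hmain : 0 ≤ R + (1 - h₂ * u₂) * (1 - g₂ * v₂) * g₁ * σ + (1 - h₂) * (1 - g₁) * (1 - g₂) * σ - ρ - g₁ * R * τ := by
    rw [hid]; nlinarith
  simpa [hR, hρ, hσdef, hτ] using hmain

/-- **Case `m = v₂`** (`q₂` is `K`-loneliest: `v₂ ≤ σ₁, u₂`), from the single row "`p₁` no more `H′`-reliable than `q₂`":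
`ρ₁ − v₂ ≤ g₁g₂Ψ`, `Ψ = (1−v₂)σ₁ − τv₂` (affine decomposition along the hair `y–q₂`):
`c′ = (g₁g₂Ψ − (ρ₁−v₂)) + g₂h₂u₂(1−v₂)(1 − g₁(σ₁+τ)) + (1−g₂)[h₂(1−g₁)(u₂−v₂) + g₁(σ₁−v₂) + h₂g₁u₂(1−σ₁−τ)]`. [this work] -/
theorem case_v (u₁ v₁ w u₂ v₂ h₂ g₁ g₂ : ℝ)
    (_hu₁ : 0 ≤ u₁) (_hu₁' : u₁ ≤ 1) (hv₁ : 0 ≤ v₁) (hv₁' : v₁ ≤ 1) (hw : 0 ≤ w) (hw' : w ≤ 1)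
    (hu₂ : 0 ≤ u₂) (_hu₂' : u₂ ≤ 1) (_hv₂ : 0 ≤ v₂) (hv₂' : v₂ ≤ 1)
    (hh₂ : 0 ≤ h₂) (_hh₂' : h₂ ≤ 1) (hg₁ : 0 ≤ g₁) (hg₁' : g₁ ≤ 1) (hg₂ : 0 ≤ g₂) (hg₂' : g₂ ≤ 1)
    (hmσ : v₂ ≤ 1 - (1 - v₁) * (1 - w * u₁)) (hmu : v₂ ≤ u₂)
    (hrow : (1 - (1 - u₁) * (1 - w * v₁)) + (1 - u₁) * (1 - v₁) * w * (g₁ * g₂ * v₂)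
      ≤ v₂ + (1 - v₂) * g₁ * g₂ * (1 - (1 - v₁) * (1 - w * u₁))) :
    0 ≤ (1 - (1 - h₂ * u₂) * (1 - g₂ * v₂))
        + (1 - h₂ * u₂) * (1 - g₂ * v₂) * g₁ * (1 - (1 - v₁) * (1 - w * u₁))
        + (1 - h₂) * (1 - g₁) * (1 - g₂) * v₂
        - (1 - (1 - u₁) * (1 - w * v₁))
        - g₁ * (1 - (1 - h₂ * u₂) * (1 - g₂ * v₂)) * ((1 - u₁) * (1 - v₁) * w) := by
  set ρ := 1 - (1 - u₁) * (1 - w * v₁) with hρ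
  set σ := 1 - (1 - v₁) * (1 - w * u₁) with hσdef
  set τ := (1 - u₁) * (1 - v₁) * w with hτ
  set R := 1 - (1 - h₂ * u₂) * (1 - g₂ * v₂) with hR
  have hS : σ + τ = v₁ + (1 - v₁) * w := by rw [hσdef, hτ]; ring
  have hS1 : σ + τ ≤ 1 := by rw [hS]; nlinarith
  have hS0 : 0 ≤ σ + τ := by rw [hS]; nlinarith [mul_nonneg (by linarith : (0:ℝ) ≤ 1 - v₁) hw]
  have hid : R + (1 - h₂ * u₂) * (1 - g₂ * v₂) * g₁ * σ + (1 - h₂) * (1 - g₁) * (1 - g₂) * v₂ - ρ - g₁ * R * τ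
      = (g₁ * g₂ * ((1 - v₂) * σ - τ * v₂) - (ρ - v₂)) + g₂ * h₂ * u₂ * (1 - v₂) * (1 - g₁ * (σ + τ))
        + (1 - g₂) * (h₂ * (1 - g₁) * (u₂ - v₂) + g₁ * (σ - v₂) + h₂ * g₁ * u₂ * (1 - σ - τ)) := by
    rw [hR]; ring
  have hrow' : 0 ≤ g₁ * g₂ * ((1 - v₂) * σ - τ * v₂) - (ρ - v₂) := by
    rw [hρ, hσdef, hτ]; nlinarith [hrow]
  have hgS : g₁ * (σ + τ) ≤ σ + τ := by nlinarith [mul_nonneg (sub_nonneg.2 hg₁') hS0]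
  have h2 : 0 ≤ g₂ * h₂ * u₂ * (1 - v₂) * (1 - g₁ * (σ + τ)) :=
    mul_nonneg (mul_nonneg (mul_nonneg (mul_nonneg hg₂ hh₂) hu₂) (by linarith)) (by linarith)
  have h3a : 0 ≤ h₂ * (1 - g₁) * (u₂ - v₂) := mul_nonneg (mul_nonneg hh₂ (by linarith)) (by linarith)
  have h3b : 0 ≤ g₁ * (σ - v₂) := mul_nonneg hg₁ (by linarith)
  have h3c : 0 ≤ h₂ * g₁ * u₂ * (1 - σ - τ) := mul_nonneg (mul_nonneg (mul_nonneg hh₂ hg₁) hu₂) (by linarith)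
  have h3 : 0 ≤ (1 - g₂) * (h₂ * (1 - g₁) * (u₂ - v₂) + g₁ * (σ - v₂) + h₂ * g₁ * u₂ * (1 - σ - τ)) :=
    mul_nonneg (by linarith) (by linarith)
  have hmain : 0 ≤ R + (1 - h₂ * u₂) * (1 - g₂ * v₂) * g₁ * σ + (1 - h₂) * (1 - g₁) * (1 - g₂) * v₂ - ρ - g₁ * R * τ := by
    rw [hid]; linarith
  simpa [hR, hρ, hσdef, hτ] using hmain

/-- **The algebraic core of the kernel in configuration (β).**  All weights in `[0,1]`; `m` is a common lower bound of
`ρ₁, σ₁, u₂, v₂` attained by one of them (`m = min`); the three rows say that `p₁` is no more `H′`-reliable than `q₁`, `p₂`, `q₂`.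
Then `c′(m) = R + (1−R)g₁σ₁ + π∅·m − ρ₁ − g₁Rτ ≥ 0`.  (Case `m = u₂` forces `ρ₁ = u₂ = m` by the `p₂`-row and is the Theorem-4 case.)
[this work] -/
theorem core (u₁ v₁ w u₂ v₂ h₂ g₁ g₂ m : ℝ)
    (hu₁ : 0 ≤ u₁) (hu₁' : u₁ ≤ 1) (hv₁ : 0 ≤ v₁) (hv₁' : v₁ ≤ 1) (hw : 0 ≤ w) (hw' : w ≤ 1)
    (hu₂ : 0 ≤ u₂) (hu₂' : u₂ ≤ 1) (hv₂ : 0 ≤ v₂) (hv₂' : v₂ ≤ 1)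
    (hh₂ : 0 ≤ h₂) (hh₂' : h₂ ≤ 1) (hg₁ : 0 ≤ g₁) (hg₁' : g₁ ≤ 1) (hg₂ : 0 ≤ g₂) (hg₂' : g₂ ≤ 1)
    (hmρ : m ≤ 1 - (1 - u₁) * (1 - w * v₁)) (hmσ : m ≤ 1 - (1 - v₁) * (1 - w * u₁)) (hmu : m ≤ u₂) (hmv : m ≤ v₂)
    (hmin : m = 1 - (1 - u₁) * (1 - w * v₁) ∨ m = 1 - (1 - v₁) * (1 - w * u₁) ∨ m = u₂ ∨ m = v₂)
    (hrow₁ : (1 - (1 - u₁) * (1 - w * v₁)) + (1 - u₁) * (1 - v₁) * w * (g₁ * g₂ * v₂)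
      ≤ (1 - (1 - v₁) * (1 - w * u₁)) + (1 - v₁) * (1 - w * u₁) * (g₁ * g₂ * v₂))
    (hrow₂ : (1 - (1 - u₁) * (1 - w * v₁)) + (1 - u₁) * (1 - v₁) * w * (g₁ * g₂ * v₂) ≤ u₂)
    (hrow₃ : (1 - (1 - u₁) * (1 - w * v₁)) + (1 - u₁) * (1 - v₁) * w * (g₁ * g₂ * v₂)
      ≤ v₂ + (1 - v₂) * g₁ * g₂ * (1 - (1 - v₁) * (1 - w * u₁))) :
    0 ≤ (1 - (1 - h₂ * u₂) * (1 - g₂ * v₂))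
        + (1 - h₂ * u₂) * (1 - g₂ * v₂) * g₁ * (1 - (1 - v₁) * (1 - w * u₁))
        + (1 - h₂) * (1 - g₁) * (1 - g₂) * m
        - (1 - (1 - u₁) * (1 - w * v₁))
        - g₁ * (1 - (1 - h₂ * u₂) * (1 - g₂ * v₂)) * ((1 - u₁) * (1 - v₁) * w) := by
  have hτG : 0 ≤ (1 - u₁) * (1 - v₁) * w * (g₁ * g₂ * v₂) :=
    mul_nonneg (mul_nonneg (mul_nonneg (by linarith) (by linarith)) hw) (mul_nonneg (mul_nonneg hg₁ hg₂) hv₂)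
  -- ρ₁ ≤ u₂ from the p₂-row
  have hρu : 1 - (1 - u₁) * (1 - w * v₁) ≤ u₂ := by linarith
  rcases hmin with hm | hm | hm | hm
  · -- m = ρ₁
    subst hm
    exact case_rho u₁ v₁ w u₂ v₂ h₂ g₁ g₂ hu₁ hu₁' hv₁ hv₁' hw hw' hu₂ hu₂' hv₂ hv₂' hh₂ hh₂' hg₁ hg₁' hg₂ hg₂' hmσ hmu hmv
  · -- m = σ₁: the q₁-row in product form
    subst hm
    have hrow : (u₁ - v₁) * (1 - w) ≤ g₁ * g₂ * v₂ * (1 - v₁) * (1 - w) := by nlinarith [hrow₁]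
    exact case_sigma u₁ v₁ w u₂ v₂ h₂ g₁ g₂ hu₁ hu₁' hv₁ hv₁' hw hw' hu₂ hu₂' hv₂ hv₂' hh₂ hh₂' hg₁ hg₁' hg₂ hg₂' hmu hmv hrow
  · -- m = u₂: then ρ₁ = u₂ = m, Theorem-4 case
    have heq : m = 1 - (1 - u₁) * (1 - w * v₁) := le_antisymm hmρ (hm ▸ hρu)
    rw [heq] at hmσ hmu hmv ⊢
    exact case_rho u₁ v₁ w u₂ v₂ h₂ g₁ g₂ hu₁ hu₁' hv₁ hv₁' hw hw' hu₂ hu₂' hv₂ hv₂' hh₂ hh₂' hg₁ hg₁' hg₂ hg₂' hmσ hmu hmv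
  · -- m = v₂
    rw [hm] at hmσ hmu ⊢
    exact case_v u₁ v₁ w u₂ v₂ h₂ g₁ g₂ hu₁ hu₁' hv₁ hv₁' hw hw' hu₂ hu₂' hv₂ hv₂' hh₂ hh₂' hg₁ hg₁' hg₂ hg₂' hmσ hmu hrow₃

end KernelBeta

end Summit.CriticalPhenomena.PercolationContinuityZ3.Theorems
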